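import Mathlib
import HarnessLib
import Literature.MathematicalPhysics.QuantumFieldTheory.ConstructiveQFTWave0
import Summits.QuantumFields.GaugeBoot.LatticeWords
import Summits.Ventures.LatticeQCDFlow.Exactness.LatticeCoordAvg
import Summits.Ventures.LatticeQCDFlow.Scaling.AutoregressiveGaugeRedundancy
import Summits.Ventures.LatticeQCDFlow.Scaling.GaugeCycleHolonomy
import Summits.Ventures.LatticeQCDFlow.Scaling.GaugeCycleForests
import Summits.Ventures.LatticeQCDFlow.Scaling.GaugeCycleTheta

/-!
# LatticeQCDFlow / Scaling — the exact autoregressive conditional of a cycle-closing link is a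
# class function of the cycle holonomy (general cycle, forests hanging off invisible); of a bouquet
# of closed cycles, of the JOINT conjugacy class of their holonomies

HONEST FRAMING: exact (Metropolis-corrected) sampling algorithms for lattice gauge theory;
figures of merit are autocorrelation/cost numbers at stated couplings and volumes; no
continuum-physics claim.

Venture `LatticeQCDFlow` (cell pub-lqcd), topic `Scaling`, FANOUT row 30 (lean-1, GEN-16) — OUR WORK,
THEORY-2.md §4 row C5 (faithfulness of the exact autoregressive / Knothe–Rosenblatt context; the
GAUGE case, in link variables).  The measure-level assembly of
`Scaling/AutoregressiveGaugeRedundancy` (GEN-15/16: partial Haar marginals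
`A_s F = Exactness.coordAvg (haarProbability G) s F` of gauge-invariant weights read the retained
links only modulo gauge relations tested on any cover of the retained set —
`coordAvg_eq_of_gaugeRelated_on_cover`, `arConditional_eq_of_gaugeRelated_on_covers`) with the
configuration-level classification `Scaling/GaugeCycleHolonomy` + `Scaling/GaugeCycleForests` +
`Scaling/GaugeCycleTheta`
(on a cycle with forests hanging off it two configurations are gauge related iff the cycle
holonomies are conjugate; on a bouquet of cycles iff the tuple of holonomies is jointly conjugate;
on a path with forests, always).  Every group `G` with its Haar probability measure, every `d`, `L`,
every gauge-invariant `F` (any coupling, any action; no continuity or integrability needed).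

* **`coordAvg_cycle_forest_classFunction`** — if the links OFF `s` (the retained links) are covered
  by a closed simple word `c :: p` from `x` and a pruning certificate `T` whose private endpoints are
  off the cycle, then `A_s F (U') = A_s F (U)` whenever `hol(U') = k · hol(U) · k⁻¹`: THE MARGINAL IS A
  CLASS FUNCTION OF THE CYCLE HOLONOMY, and reads nothing else (in particular none of the forest).
* **`coordAvg_path_forest_const`** — if the retained links are covered by a simple open word and such
  a forest, `A_s F` is CONSTANT (`A_s F (U') = A_s F (U)` for all `U, U'`).
* **`arConditional_cycle_classFunction`** — THE AUTOREGRESSIVE READING: generate the links of `T` and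
  of the path `p`, then the link `a = c.edge x` closing the cycle (everything else, `s`, not yet
  generated): the exact conditional density `A_s F / A_{insert a s} F` of `U_a` given the generated
  links takes the same value on any two configurations with conjugate cycle holonomies — one
  class-valued context (the conjugacy class of link × (holonomy of the rest of the cycle)) replaces
  the whole symbolic context; GEN-15's `arConditional_plaquette_classFunction` is the plaquette case.
* **`coordAvg_bouquet_classFunction`** — retained links covered by a bouquet of closed simple words
  through `x` pairwise meeting only at `x`: `A_s F (U') = A_s F (U)` whenever ONE `k` conjugates ALL
  the holonomies; the marginal reads at most the JOINT conjugacy class of the tuple;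
  `coordAvg_bouquet_path_classFunction` (one more open petal adds nothing).
* **`arConditional_bouquet_classFunction`** — CLOSING THE `r`-TH CYCLE THROUGH A POINT: the exact
  conditional of the closing link of a new petal, given a bouquet of `r − 1` closed petals and the rest
  of the new one, takes the same value on configurations whose `r` holonomies are conjugated by ONE
  common `k` — it reads at most the joint conjugacy class of the `r`-tuple.
* `coordAvg_cycle_path_classFunction`, **`coordAvg_theta_classFunction`**,
  **`arConditional_theta_classFunction`** — two cycles SHARING A PATH (theta graph; two adjacent
  plaquettes, `Scaling/GaugeCycleTheta`): the marginal reads at most the joint class of the two based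
  loop holonomies, and so does the exact conditional of the link closing the second cycle (the
  denominator — cycle plus open ear — reads only the first cycle's class).

READING (value-free, for THEORY-2 §4 C5 / T2-AF): in link variables the faithful unit of exact
autoregressive context for a pure gauge theory is not a link but a holonomy class: forests and
dangling trees are invisible (GEN-15), the link closing a cycle reads the retained cycle through ONE
conjugacy class, and after `r` cycles through the retained structure are closed the context is at
most the joint conjugacy class of an `r`-tuple — for every gauge group, weight and coupling.  NOT
CLAIMED: any LOWER bound (that the Wilson conditional does depend on the full joint class — expected
for `β ≠ 0`, not typed); cycles meeting along paths rather than at a point (the ear lemma of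
`GaugeCycleHolonomy` is the general step, not assembled here); anything about approximate samplers;
any number of ours.  Elementary over the three parents; no definition is introduced; nothing is
cited as a fact; no `sorry`.
-/

noncomputable section

namespace Summit.Ventures.LatticeQCDFlow.Theory2.Autoregressive

open MeasureTheory Function
open Literature.MathematicalPhysics.QuantumFieldTheory
open Summit.Ventures.LatticeQCDFlow.Exactness
open Summit.QuantumFields.GaugeBoot

variable {d L : ℕ} {G : Type*} [Group G]
variable [TopologicalSpace G] [IsTopologicalGroup G] [CompactSpace G] [MeasurableSpace G]
  [BorelSpace G]

/-- **THE MARGINAL OVER A CYCLE WITH FORESTS HANGING OFF IT IS A CLASS FUNCTION OF THE CYCLE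
HOLONOMY.**  Let the links off `s` be covered by the links of a closed simple word `c :: p` from `x`
and of a pruning certificate `T` with private endpoints off the cycle.  For gauge-invariant `F`, two
configurations with conjugate cycle holonomies have the same partial Haar marginal `A_s F`. [ours] -/
theorem coordAvg_cycle_forest_classFunction [NeZero L] (s : Finset (Edge d L))
    {F : GaugeConfig d L G → ℝ} (hF : IsGaugeInvariant F) (x : Site d L) (c : Step d)
    (p : Word d) (hclosed : Word.endpoint x (c :: p) = x)
    (hnd : (p.scanl Step.apply (c.apply x)).Nodup) (T : List (Edge d L × Site d L))
    (hinc : ∀ q ∈ T, (q.1.1 = q.2 ∨ q.1.1.shift q.1.2 = q.2) ∧ q.1.1 ≠ q.1.1.shift q.1.2)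
    (hpw : T.Pairwise (fun q r => ¬ (r.1.1 = q.2 ∨ r.1.1.shift r.1.2 = q.2)))
    (hoff : ∀ q ∈ T, q.2 ∉ (c :: p).scanl Step.apply x)
    (hcover : ∀ e, e ∉ s →
      e ∈ List.zipWith Step.edge ((c :: p).scanl Step.apply x) (c :: p) ∨ ∃ q ∈ T, e = q.1)
    {U U' : GaugeConfig d L G} (k : G)
    (hhol : wordHolonomy U' x (c :: p) = k * wordHolonomy U x (c :: p) * k⁻¹) :
    coordAvg (haarProbability G) s F U' = coordAvg (haarProbability G) s F U := by
  obtain ⟨γ, -, hγc, hγT⟩ :=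
    exists_gaugeTransform_eq_on_cycle_forest U U' x c p hclosed hnd T hinc hpw hoff k hhol
  refine coordAvg_eq_of_gaugeRelated_on_cover s hF hcover γ fun e he => ?_
  rcases he with he | ⟨q, hq, rfl⟩
  · exact hγc e he
  · exact hγT q hq

/-- **THE MARGINAL OVER A PATH WITH FORESTS HANGING OFF IT IS CONSTANT.**  If the links off `s` are
covered by a simple open word `w` from `x` and a pruning certificate `T` with private endpoints off
the path (together a forest), then `A_s F (U') = A_s F (U)` for ALL `U, U'` and every gauge-invariant
`F`. [ours] -/
theorem coordAvg_path_forest_const [NeZero L] (s : Finset (Edge d L))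
    {F : GaugeConfig d L G → ℝ} (hF : IsGaugeInvariant F) (w : Word d) (x : Site d L)
    (hnd : (w.scanl Step.apply x).Nodup) (T : List (Edge d L × Site d L))
    (hinc : ∀ q ∈ T, (q.1.1 = q.2 ∨ q.1.1.shift q.1.2 = q.2) ∧ q.1.1 ≠ q.1.1.shift q.1.2)
    (hpw : T.Pairwise (fun q r => ¬ (r.1.1 = q.2 ∨ r.1.1.shift r.1.2 = q.2)))
    (hoff : ∀ q ∈ T, q.2 ∉ w.scanl Step.apply x)
    (hcover : ∀ e, e ∉ s →
      e ∈ List.zipWith Step.edge (w.scanl Step.apply x) w ∨ ∃ q ∈ T, e = q.1)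
    (U U' : GaugeConfig d L G) :
    coordAvg (haarProbability G) s F U' = coordAvg (haarProbability G) s F U := by
  obtain ⟨γ, hγw, hγT⟩ := exists_gaugeTransform_eq_on_path_forest U U' w x hnd T hinc hpw hoff
  refine coordAvg_eq_of_gaugeRelated_on_cover s hF hcover γ fun e he => ?_
  rcases he with he | ⟨q, hq, rfl⟩
  · exact hγw e he
  · exact hγT q hq

/-- **CLOSING A CYCLE READS ONE HOLONOMY CLASS (general cycle).**  Generate the links of a pruning
certificate `T` and of a simple path `p`, and then the link `a = c.edge x` closing the simple cycle
`c :: p` through `x` (all other links, `s`, not yet generated; `T`'s private endpoints off the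
cycle).  For every gauge-invariant weight `F` the exact conditional density
`A_s F / A_{insert a s} F` of `U_a` given the generated links takes the same value on any two
configurations with CONJUGATE cycle holonomies: numerator by `coordAvg_cycle_forest_classFunction`,
denominator CONSTANT by `coordAvg_path_forest_const` (removing `a` leaves a forest). [ours] -/
theorem arConditional_cycle_classFunction [NeZero L] (s : Finset (Edge d L))
    {F : GaugeConfig d L G → ℝ} (hF : IsGaugeInvariant F) (x : Site d L) (c : Step d)
    (p : Word d) (hclosed : Word.endpoint x (c :: p) = x)
    (hnd : (p.scanl Step.apply (c.apply x)).Nodup) (T : List (Edge d L × Site d L))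
    (hinc : ∀ q ∈ T, (q.1.1 = q.2 ∨ q.1.1.shift q.1.2 = q.2) ∧ q.1.1 ≠ q.1.1.shift q.1.2)
    (hpw : T.Pairwise (fun q r => ¬ (r.1.1 = q.2 ∨ r.1.1.shift r.1.2 = q.2)))
    (hoff : ∀ q ∈ T, q.2 ∉ (c :: p).scanl Step.apply x)
    (hcover : ∀ e, e ∉ s →
      e ∈ List.zipWith Step.edge ((c :: p).scanl Step.apply x) (c :: p) ∨ ∃ q ∈ T, e = q.1)
    {U U' : GaugeConfig d L G} (k : G)
    (hhol : wordHolonomy U' x (c :: p) = k * wordHolonomy U x (c :: p) * k⁻¹) :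
    coordAvg (haarProbability G) s F U' /
        coordAvg (haarProbability G) (insert (c.edge x) s) F U' =
      coordAvg (haarProbability G) s F U /
        coordAvg (haarProbability G) (insert (c.edge x) s) F U := by
  have hoff' : ∀ q ∈ T, q.2 ∉ p.scanl Step.apply (c.apply x) := fun q hq h =>
    hoff q hq (by rw [scanl_apply_cons]; exact List.mem_cons_of_mem _ h)
  have hcover' : ∀ e, e ∉ insert (c.edge x) s →
      e ∈ List.zipWith Step.edge (p.scanl Step.apply (c.apply x)) p ∨ ∃ q ∈ T, e = q.1 := by
    intro e he
    rw [Finset.mem_insert, not_or] at he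
    rcases hcover e he.2 with h | h
    · rw [zipWith_edge_cons, List.mem_cons] at h
      rcases h with h | h
      · exact absurd h he.1
      · exact Or.inl h
    · exact Or.inr h
  rw [coordAvg_cycle_forest_classFunction s hF x c p hclosed hnd T hinc hpw hoff hcover k hhol,
    coordAvg_path_forest_const (insert (c.edge x) s) hF p (c.apply x) hnd T hinc hpw hoff' hcover'
      U U']

/-- **THE MARGINAL OVER A BOUQUET OF CYCLES READS AT MOST THE JOINT CONJUGACY CLASS OF THE TUPLE OF
HOLONOMIES.**  If the links off `s` are covered by a list `C` of closed simple words from `x`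
pairwise meeting only at `x`, then `A_s F (U') = A_s F (U)` for gauge-invariant `F` whenever ONE `k`
conjugates all the petal holonomies of `U` into those of `U'`. [ours] -/
theorem coordAvg_bouquet_classFunction [NeZero L] (s : Finset (Edge d L))
    {F : GaugeConfig d L G → ℝ} (hF : IsGaugeInvariant F) (x : Site d L)
    (C : List (Step d × Word d)) (hclosed : ∀ c ∈ C, Word.endpoint x (c.1 :: c.2) = x)
    (hnd : ∀ c ∈ C, (c.2.scanl Step.apply (c.1.apply x)).Nodup)
    (hmeet : C.Pairwise (fun c c' => ∀ y ∈ c'.2.scanl Step.apply (c'.1.apply x),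
      y ∈ (c.1 :: c.2).scanl Step.apply x → y = x))
    (hcover : ∀ e, e ∉ s →
      ∃ c ∈ C, e ∈ List.zipWith Step.edge ((c.1 :: c.2).scanl Step.apply x) (c.1 :: c.2))
    {U U' : GaugeConfig d L G} (k : G)
    (hhol : ∀ c ∈ C, wordHolonomy U' x (c.1 :: c.2) = k * wordHolonomy U x (c.1 :: c.2) * k⁻¹) :
    coordAvg (haarProbability G) s F U' = coordAvg (haarProbability G) s F U := by
  obtain ⟨γ, hγ⟩ := (gaugeRelated_on_bouquet_iff U U' x C hclosed hnd hmeet).2 ⟨k, hhol⟩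
  refine coordAvg_eq_of_gaugeRelated_on_cover s hF hcover γ fun e he => ?_
  obtain ⟨c, hc, he⟩ := he
  exact hγ c hc e he

/-- **The marginal over a bouquet plus one open petal reads at most the joint class of the CLOSED
petals** (the open path adds nothing): if the links off `s` are covered by the petals of `C` and by a
simple path `w` from `y` ending at `x` (otherwise off the bouquet), then `A_s F (U') = A_s F (U)`
whenever one `k` conjugates all the closed petals' holonomies. [ours] -/
theorem coordAvg_bouquet_path_classFunction [NeZero L] (s : Finset (Edge d L))
    {F : GaugeConfig d L G → ℝ} (hF : IsGaugeInvariant F) (x : Site d L)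
    (C : List (Step d × Word d)) (hclosed : ∀ c ∈ C, Word.endpoint x (c.1 :: c.2) = x)
    (hnd : ∀ c ∈ C, (c.2.scanl Step.apply (c.1.apply x)).Nodup)
    (hmeet : C.Pairwise (fun c c' => ∀ y ∈ c'.2.scanl Step.apply (c'.1.apply x),
      y ∈ (c.1 :: c.2).scanl Step.apply x → y = x))
    (w : Word d) (y : Site d L) (hwnd : (w.scanl Step.apply y).Nodup)
    (hwend : Word.endpoint y w = x)
    (hwmeet : ∀ z ∈ w.scanl Step.apply y, ∀ c ∈ C, z ∈ (c.1 :: c.2).scanl Step.apply x → z = x)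
    (hcover : ∀ e, e ∉ s →
      (∃ c ∈ C, e ∈ List.zipWith Step.edge ((c.1 :: c.2).scanl Step.apply x) (c.1 :: c.2)) ∨
        e ∈ List.zipWith Step.edge (w.scanl Step.apply y) w)
    {U U' : GaugeConfig d L G} (k : G)
    (hhol : ∀ c ∈ C, wordHolonomy U' x (c.1 :: c.2) = k * wordHolonomy U x (c.1 :: c.2) * k⁻¹) :
    coordAvg (haarProbability G) s F U' = coordAvg (haarProbability G) s F U := by
  obtain ⟨γ, -, hγC, hγw⟩ := exists_gaugeTransform_eq_on_bouquet_path U U' x k C hclosed hnd hmeet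
    w y hwnd hwend hwmeet hhol
  refine coordAvg_eq_of_gaugeRelated_on_cover s hF hcover γ fun e he => ?_
  rcases he with ⟨c, hc, he⟩ | he
  · exact hγC c hc e he
  · exact hγw e he

/-- **CLOSING THE `r`-TH CYCLE THROUGH A POINT READS THE JOINT CLASS OF ALL `r` HOLONOMIES (and at
most that).**  Retained structure: a bouquet `C` of closed simple words through `x` (pairwise meeting
only at `x`) and one more closed simple word `c :: p` through `x` meeting the bouquet only at `x`;
generate everything but the closing link `a = c.edge x` of the new petal, then `a` (all other links,
`s`, not yet generated).  For every gauge-invariant weight `F` the exact conditional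
`A_s F / A_{insert a s} F` of `U_a` takes the same value on any two configurations whose `r = |C| + 1`
petal holonomies are conjugated by ONE common `k`: numerator by `coordAvg_bouquet_classFunction` for
the bouquet `(c, p) :: C`, denominator by `coordAvg_bouquet_path_classFunction` (removing `a` leaves
the bouquet `C` plus the open petal `p`). [ours] -/
theorem arConditional_bouquet_classFunction [NeZero L] (s : Finset (Edge d L))
    {F : GaugeConfig d L G → ℝ} (hF : IsGaugeInvariant F) (x : Site d L) (c : Step d) (p : Word d)
    (C : List (Step d × Word d)) (hclosed : ∀ c' ∈ (c, p) :: C, Word.endpoint x (c'.1 :: c'.2) = x)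
    (hnd : ∀ c' ∈ (c, p) :: C, (c'.2.scanl Step.apply (c'.1.apply x)).Nodup)
    (hmeet : ((c, p) :: C).Pairwise (fun c₁ c₂ => ∀ y ∈ c₂.2.scanl Step.apply (c₂.1.apply x),
      y ∈ (c₁.1 :: c₁.2).scanl Step.apply x → y = x))
    (hcover : ∀ e, e ∉ s → ∃ c' ∈ (c, p) :: C,
      e ∈ List.zipWith Step.edge ((c'.1 :: c'.2).scanl Step.apply x) (c'.1 :: c'.2))
    {U U' : GaugeConfig d L G} (k : G)
    (hhol : ∀ c' ∈ (c, p) :: C,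
      wordHolonomy U' x (c'.1 :: c'.2) = k * wordHolonomy U x (c'.1 :: c'.2) * k⁻¹) :
    coordAvg (haarProbability G) s F U' /
        coordAvg (haarProbability G) (insert (c.edge x) s) F U' =
      coordAvg (haarProbability G) s F U /
        coordAvg (haarProbability G) (insert (c.edge x) s) F U := by
  obtain ⟨hcC, hmeet'⟩ := List.pairwise_cons.1 hmeet
  have hpc : Word.endpoint (c.apply x) p = x := by
    have := hclosed (c, p) List.mem_cons_self
    rwa [Word.endpoint_cons] at this
  -- the open petal `p` (from `c.apply x` to `x`) meets the other petals only at `x`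
  have hwmeet : ∀ z ∈ p.scanl Step.apply (c.apply x), ∀ c' ∈ C,
      z ∈ (c'.1 :: c'.2).scanl Step.apply x → z = x := by
    intro z hz c' hc' hz'
    rw [scanl_apply_cons, List.mem_cons] at hz'
    rcases hz' with rfl | hz'
    · rfl
    · -- `z` is visited after `x` by the petal `c'` and lies on the new petal: it is `x`
      exact hcC c' hc' z hz' (by rw [scanl_apply_cons]; exact List.mem_cons_of_mem _ hz)
  have hcover' : ∀ e, e ∉ insert (c.edge x) s →
      (∃ c' ∈ C, e ∈ List.zipWith Step.edge ((c'.1 :: c'.2).scanl Step.apply x) (c'.1 :: c'.2)) ∨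
        e ∈ List.zipWith Step.edge (p.scanl Step.apply (c.apply x)) p := by
    intro e he
    rw [Finset.mem_insert, not_or] at he
    obtain ⟨c', hc', he'⟩ := hcover e he.2
    rcases List.mem_cons.1 hc' with rfl | hc'C
    · rw [zipWith_edge_cons, List.mem_cons] at he'
      rcases he' with h | h
      · exact absurd h he.1
      · exact Or.inr h
    · exact Or.inl ⟨c', hc'C, he'⟩
  rw [coordAvg_bouquet_classFunction s hF x ((c, p) :: C) hclosed hnd hmeet hcover k hhol,
    coordAvg_bouquet_path_classFunction (insert (c.edge x) s) hF x C
      (fun c' hc' => hclosed c' (List.mem_cons_of_mem _ hc'))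
      (fun c' hc' => hnd c' (List.mem_cons_of_mem _ hc')) hmeet' p (c.apply x)
      (hnd (c, p) List.mem_cons_self) hpc hwmeet hcover' k
      (fun c' hc' => hhol c' (List.mem_cons_of_mem _ hc'))]

/-- **The marginal over a cycle with an OPEN ear hanging from it is a class function of the cycle
holonomy** (the ear adds nothing): retained links covered by a closed simple word `c :: p` from `y`
and a simple open path `q` from `y₁` ending on the cycle, otherwise off it. [ours] -/
theorem coordAvg_cycle_path_classFunction [NeZero L] (s : Finset (Edge d L))
    {F : GaugeConfig d L G → ℝ} (hF : IsGaugeInvariant F) (y : Site d L) (c : Step d) (p : Word d)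
    (hCclosed : Word.endpoint y (c :: p) = y) (hCnd : (p.scanl Step.apply (c.apply y)).Nodup)
    (q : Word d) (y₁ : Site d L) (hqnd : (q.scanl Step.apply y₁).Nodup)
    (hqoff : ∀ v ∈ q.scanl Step.apply y₁, v ∈ (c :: p).scanl Step.apply y →
      v = Word.endpoint y₁ q)
    (hcover : ∀ e, e ∉ s →
      e ∈ List.zipWith Step.edge ((c :: p).scanl Step.apply y) (c :: p) ∨
        e ∈ List.zipWith Step.edge (q.scanl Step.apply y₁) q)
    {U U' : GaugeConfig d L G} (k : G)
    (hkC : wordHolonomy U' y (c :: p) = k * wordHolonomy U y (c :: p) * k⁻¹) :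
    coordAvg (haarProbability G) s F U' = coordAvg (haarProbability G) s F U := by
  obtain ⟨γ, -, hγC, hγq⟩ :=
    exists_gaugeTransform_eq_on_cycle_path U U' y c p hCclosed hCnd q y₁ hqnd hqoff k hkC
  refine coordAvg_eq_of_gaugeRelated_on_cover s hF hcover γ fun e he => ?_
  rcases he with he | he
  · exact hγC e he
  · exact hγq e he

/-- **THE MARGINAL OVER A THETA GRAPH (two cycles sharing a path — e.g. two adjacent plaquettes) READS
AT MOST THE JOINT CLASS OF THE TWO BASED LOOP HOLONOMIES**: retained links covered by a closed
simple word `C = c :: p = A ++ B` from `y` and an ear `E = e :: q` from `y` to `end(A)` meeting `C`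
only there; `A_s F (U') = A_s F (U)` whenever one `k` conjugates both `hol(C)` and `hol(E ++ B)`.
[ours] -/
theorem coordAvg_theta_classFunction [NeZero L] (s : Finset (Edge d L))
    {F : GaugeConfig d L G → ℝ} (hF : IsGaugeInvariant F) (y : Site d L) (c : Step d) (p : Word d)
    (hCclosed : Word.endpoint y (c :: p) = y) (hCnd : (p.scanl Step.apply (c.apply y)).Nodup)
    (A B : Word d) (hAB : c :: p = A ++ B) (e : Step d) (q : Word d)
    (hEend : Word.endpoint y (e :: q) = Word.endpoint y A)
    (hEnd : (q.scanl Step.apply (e.apply y)).Nodup)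
    (hEoff : ∀ v ∈ q.scanl Step.apply (e.apply y),
      v ∈ (c :: p).scanl Step.apply y → v = Word.endpoint y A)
    (hcover : ∀ l, l ∉ s →
      l ∈ List.zipWith Step.edge ((c :: p).scanl Step.apply y) (c :: p) ∨
        l ∈ List.zipWith Step.edge ((e :: q).scanl Step.apply y) (e :: q))
    {U U' : GaugeConfig d L G} (k : G)
    (hkC : wordHolonomy U' y (c :: p) = k * wordHolonomy U y (c :: p) * k⁻¹)
    (hkD : wordHolonomy U' y ((e :: q) ++ B) = k * wordHolonomy U y ((e :: q) ++ B) * k⁻¹) :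
    coordAvg (haarProbability G) s F U' = coordAvg (haarProbability G) s F U := by
  obtain ⟨γ, -, hγC, hγE⟩ := exists_gaugeTransform_eq_on_theta U U' y c p hCclosed hCnd A B hAB e q
    hEend hEnd hEoff k hkC hkD
  refine coordAvg_eq_of_gaugeRelated_on_cover s hF hcover γ fun l hl => ?_
  rcases hl with hl | hl
  · exact hγC l hl
  · exact hγE l hl

/-- **CLOSING A SECOND CYCLE ALONG A SHARED PATH READS THE JOINT CLASS OF BOTH LOOPS (and at most
that).**  Retained structure: the cycle `C = c :: p` through `y` and the ear `E = e :: q` from `y`;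
generate everything but the ear's first link `a = e.edge y`, then `a`.  The exact conditional
`A_s F / A_{insert a s} F` of `U_a` takes the same value on configurations whose two based loop
holonomies `hol(C)`, `hol(E ++ B)` are conjugated by ONE common `k` (numerator: theta; denominator:
removing `a` leaves the cycle with the open path `q` hanging from it — a class function of `hol(C)`
alone). [ours] -/
theorem arConditional_theta_classFunction [NeZero L] (s : Finset (Edge d L))
    {F : GaugeConfig d L G → ℝ} (hF : IsGaugeInvariant F) (y : Site d L) (c : Step d) (p : Word d)
    (hCclosed : Word.endpoint y (c :: p) = y) (hCnd : (p.scanl Step.apply (c.apply y)).Nodup)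
    (A B : Word d) (hAB : c :: p = A ++ B) (e : Step d) (q : Word d)
    (hEend : Word.endpoint y (e :: q) = Word.endpoint y A)
    (hEnd : (q.scanl Step.apply (e.apply y)).Nodup)
    (hEoff : ∀ v ∈ q.scanl Step.apply (e.apply y),
      v ∈ (c :: p).scanl Step.apply y → v = Word.endpoint y A)
    (hcover : ∀ l, l ∉ s →
      l ∈ List.zipWith Step.edge ((c :: p).scanl Step.apply y) (c :: p) ∨
        l ∈ List.zipWith Step.edge ((e :: q).scanl Step.apply y) (e :: q))
    {U U' : GaugeConfig d L G} (k : G)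
    (hkC : wordHolonomy U' y (c :: p) = k * wordHolonomy U y (c :: p) * k⁻¹)
    (hkD : wordHolonomy U' y ((e :: q) ++ B) = k * wordHolonomy U y ((e :: q) ++ B) * k⁻¹) :
    coordAvg (haarProbability G) s F U' / coordAvg (haarProbability G) (insert (e.edge y) s) F U' =
      coordAvg (haarProbability G) s F U /
        coordAvg (haarProbability G) (insert (e.edge y) s) F U := by
  have hqoff : ∀ v ∈ q.scanl Step.apply (e.apply y), v ∈ (c :: p).scanl Step.apply y →
      v = Word.endpoint (e.apply y) q := by
    intro v hv hv'
    rw [hEoff v hv hv', ← hEend, Word.endpoint_cons]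
  have hcover' : ∀ l, l ∉ insert (e.edge y) s →
      l ∈ List.zipWith Step.edge ((c :: p).scanl Step.apply y) (c :: p) ∨
        l ∈ List.zipWith Step.edge (q.scanl Step.apply (e.apply y)) q := by
    intro l hl
    rw [Finset.mem_insert, not_or] at hl
    rcases hcover l hl.2 with h | h
    · exact Or.inl h
    · rw [zipWith_edge_cons, List.mem_cons] at h
      rcases h with h | h
      · exact absurd h hl.1
      · exact Or.inr h
  rw [coordAvg_theta_classFunction s hF y c p hCclosed hCnd A B hAB e q hEend hEnd hEoff hcover k
      hkC hkD,
    coordAvg_cycle_path_classFunction (insert (e.edge y) s) hF y c p hCclosed hCnd q (e.apply y)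
      hEnd hqoff hcover' k hkC]

end Summit.Ventures.LatticeQCDFlow.Theory2.Autoregressive

end
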